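import Literature.NumberTheory.GaloisRepresentations.LocalUnitsFundamentalClass
import Literature.NumberTheory.GaloisRepresentations.LocalUnitsValuationRep
import Literature.Algebra.Homology.UnramifiedCohomologySplitting
import Mathlib.Algebra.Category.ModuleCat.Biproducts
import HarnessLib

/-!
# The unramified layers `K_m/K` of a non-archimedean local field are unramified class modules:
# the units are cohomologically trivial, `u_{K_m/K} = [c · π_K]`, `inv(u_{K_m/K}) = 1/m`
# (Serre, *Local Fields* XII §3 Prop. 4, XIII §3; Neukirch, *Bonn Lectures* II §4 Thm. (4.3)–(4.6))

Topic `NumberTheory/GaloisRepresentations` (local class field theory); namespaces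
`Literature.NumberTheory.GaloisRepresentations.LocalWeilDatum` / `….UnitsLayer` (continuing
`LocalUnitsValuationRep` — the valuation `v_L : Lˣ → ℤ` of `L ⊆ K̄` as a morphism of representations, step
(A1) of memo FINDING-door-c6-g8 §4 — and `LocalUnitsFundamentalClass` — every finite Galois layer of a
local field is a class module).  Proof file: theorems only (no definition, no named fact, no instance,
no notation; D-0026).

For `K` a non-archimedean local field and `K_m = K(ζ_{q^m-1}) ⊆ K̄` its unramified level
(`LocalWeilDatum.unramifiedLevel K m`, cyclic of degree `m` over `K`), with `A = K_mˣ`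
(`Rep.ofAlgebraAutOnUnits K K_m`), `v = v_{K_m}` (`LocalWeilDatum.unitsValuation`) and `U = ker v` the
units:

* §1 `LocalWeilDatum.fDeg_unramifiedLevel : f_{K_m} = m`; `exists_invariant_unitsValuation_eq_one`: a
  uniformiser `π_K` of `K` is a `Gal(K_m/K)`-invariant element of `K_mˣ` with `v_{K_m}(π_K) = 1`
  (`e(K_m/K) = 1`) — the splitting datum of Serre XII §3 Prop. 4.
* §2 `natCard_H2_res_trivial_int_of_isCyclic : |H²(H, ℤ)| = |H|` for every subgroup of a finite cyclic
  group (engine `FiniteCyclic.groupCohomologyIsoEvenOfIsTrivial`).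
* §3 **`isCohomologicallyTrivial_units_unramifiedLevel`: `U_{K_m}` is cohomologically trivial** as a
  `Gal(K_m/K)`-module (Neukirch II (4.3); Serre XII §3 Lemma 2/Prop. 4) — NOT by the unit filtration but
  by COUNTING through the engine's split sequences `0 → Hⁿ(H, U) → Hⁿ(H, K_mˣ) → Hⁿ(H, ℤ) → 0`
  (`Unramified.valuationShortComplex_map_res_shortExact`): `H¹(H, K_mˣ) = 0` (Hilbert 90) kills
  `H¹(H, U)`, and `|H²(H, K_mˣ)| = |H| = |H²(H, ℤ)|` (`natCard_H2_res_units_of_isGalois`, every local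
  layer being a class module; §2) kills `H²(H, U)`; then Neukirch I (7.1) (`isCohomologicallyTrivial_of_H1_H2`).
* §4 **`isUnramified_unramifiedLevel`**: for any generator `σ` of `Gal(K_m/K)` the data
  `(σ, K_mˣ, v_{K_m}, π_K)` is an unramified layer in the sense of the engine
  (`Unramified.IsUnramified`), hence (engine, Neukirch II (4.5)–(4.6)) `K_mˣ` is a class module with
  fundamental class the Frobenius class `[c_σ · π_K]` and `inv_σ([c_σ · π_K]) = 1/m`:
  `exists_isUnramified_unramifiedLevel`, `exists_isClassModule_invariantMap_eq_unramifiedLevel`.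
  (Which generator is THE arithmetic Frobenius — the normalisation matching the tree's
  `Prop121vii.invLevel` — is not decided here.)

## References
* J.-P. Serre, *Local Fields*, GTM 67 (1979), Ch. XII §3 Lemma 2, Prop. 4; Ch. XIII §3 (the invariant of
  the unramified Brauer classes). [SerreLocalFields1979]
* J. Neukirch, *Class Field Theory — The Bonn Lectures* (2013), Part II §4 Thm. (4.3), Def. (4.5),
  Thm. (4.6); Part I §7 Thm. (7.1). [Neukirch2013]
-/

noncomputable section

open CategoryTheory CategoryTheory.Limits groupCohomology

namespace Literature.NumberTheory.GaloisRepresentations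

/-! ## §1. `f_{K_m} = m` and the invariant uniformiser `π_K ∈ K_mˣ`, `v_{K_m}(π_K) = 1` -/

namespace LocalWeilDatum

open IsNonarchimedeanLocalField IntermediateField ValuativeRel
open scoped Valued

variable (F : Type) [Field F] [ValuativeRel F] [TopologicalSpace F] [IsNonarchimedeanLocalField F]

omit [ValuativeRel F] [TopologicalSpace F] [IsNonarchimedeanLocalField F] in
/-- `f` does not depend on the presentation of the intermediate field (transport along an equality).
[cite: SerreLocalFields1979, Ch. II §2 Cor. 3] -/
theorem fDeg_congr [ValuativeRel F] [TopologicalSpace F] [IsNonarchimedeanLocalField F]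
    {X Y : IntermediateField F (AlgebraicClosure F)} (h : X = Y)
    [FiniteDimensional F X] [FiniteDimensional F Y] : fDeg F X = fDeg F Y := by
  subst h
  rfl

/-- **`f_{F_m} = m`**: the residue degree of the unramified level is its degree
(`f_{K_m} = m` for `K₁ = ⊥`, `f_{K₁} = 1`). [cite: SerreLocalFields1979, Ch. XIII §3][cite: NeukirchANT1999, Ch. IV §4] -/
theorem fDeg_unramifiedLevel {m : ℕ} (hm : 0 < m) :
    haveI := finiteDimensional_unramifiedLevel F hm
    fDeg F (unramifiedLevel F m) = m := by
  haveI := finiteDimensional_unramifiedLevel F hm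
  obtain ⟨K₁, hK₁⟩ : ∃ K₁ : IntermediateField F (AlgebraicClosure F), K₁ = ⊥ := ⟨⊥, rfl⟩
  haveI : FiniteDimensional F K₁ :=
    (IntermediateField.equivOfEq hK₁).symm.toLinearEquiv.finiteDimensional
  have hf : fDeg F K₁ = 1 := fDeg_eq_one_of_eq_bot F K₁ hK₁
  haveI := finiteDimensional_unrLevel F K₁ hm
  have h := fDeg_unrLevel F K₁ (hK₁ ▸ bot_le) hm (by rw [hf]; exact one_dvd m)
  have hT : unrLevel F K₁ m = unramifiedLevel F m := by rw [unrLevel, hK₁, bot_sup_eq]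
  rw [← fDeg_congr F hT]
  exact h

/-- **The splitting datum of the unramified layer: a uniformiser `π_F` of `F` is a
`Gal(F_m/F)`-invariant element of `F_mˣ` with `v_{F_m}(π_F) = 1`** (`e(F_m/F) = 1`:
`t_{F_m}(π_F) = ord_F(π_F^m) = m = f_{F_m}`).
[cite: SerreLocalFields1979, Ch. XII §3 (before Lemma 2: "`v` denotes the valuation of `L` which
prolongs the one on `K` with ramification index `1` … choosing a uniformizer of `K`")]
[cite: Neukirch2013, Part II §4 (proof of (4.3))] -/
theorem exists_invariant_unitsValuation_eq_one {m : ℕ} (hm : 0 < m) :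
    haveI := finiteDimensional_unramifiedLevel F hm
    ∃ ϖ : (Rep.ofAlgebraAutOnUnits F (unramifiedLevel F m)).V,
      (∀ g : unramifiedLevel F m ≃ₐ[F] unramifiedLevel F m,
        (Rep.ofAlgebraAutOnUnits F (unramifiedLevel F m)).ρ g ϖ = ϖ) ∧
      (unitsValuation F (unramifiedLevel F m) (unramifiedLevel_le_sepClosure F hm)).hom ϖ = 1 := by
  haveI := finiteDimensional_unramifiedLevel F hm
  obtain ⟨π, hπ⟩ := IsDiscreteValuationRing.exists_irreducible 𝒪[F]
  have hπ0 : (π : F) ≠ 0 := fun h => hπ.ne_zero (Subtype.ext h)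
  have hπL : algebraMap F (unramifiedLevel F m) (π : F) ≠ 0 := (map_ne_zero _).2 hπ0
  refine ⟨Additive.ofMul (Units.mk0 _ hπL), fun g => ?_, ?_⟩
  · -- `A.ρ g (ofMul u) = ofMul (Units.map g u)` definitionally, and `g (π) = π`
    change Additive.ofMul (Units.map (g : unramifiedLevel F m →* unramifiedLevel F m) (Units.mk0 _ hπL)) =
      Additive.ofMul (Units.mk0 _ hπL)
    refine congrArg Additive.ofMul (Units.ext ?_)
    rw [Units.coe_map, MonoidHom.coe_coe, Units.val_mk0]
    exact g.commutes (π : F)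
  · rw [unitsValuation_apply]
    change tVal F (unramifiedLevel F m) (algebraMap F (unramifiedLevel F m) (π : F)) /
      (fDeg F (unramifiedLevel F m) : ℤ) = 1
    rw [show fDeg F (unramifiedLevel F m) = m from fDeg_unramifiedLevel F hm]
    unfold tVal
    rw [Algebra.norm_algebraMap, finrank_unramifiedLevel F hm, ord_pow F hπ0,
      ord_eq_one_of_irreducible F hπ, mul_one]
    exact Int.ediv_self (by exact_mod_cast hm.ne')

end LocalWeilDatum

/-! ## §2. `|H²(H, ℤ)| = |H|` for the subgroups of a finite cyclic group -/

namespace UnitsLayer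

open Literature.Algebra.Homology IntermediateField LocalWeilDatum

/-- **`|H²(H, ℤ)| = |H|`** for every subgroup `H` of a finite cyclic group `G` (`H` is cyclic and
`H²(H, ℤ) ≅ ℤ/|H|`). [cite: Neukirch2013, Part II §4 Thm. (4.6) (proof, Axiom II)]
[cite: SerreLocalFields1979, Ch. VIII §4] -/
theorem natCard_H2_res_trivial_int_of_isCyclic {G : Type} [Group G] [Finite G] [IsCyclic G]
    (H : Subgroup G) :
    Nat.card (groupCohomology (Rep.res H.subtype (Rep.trivial ℤ G ℤ)) 2) = Nat.card H := by
  letI : CommGroup H := IsCyclic.commGroup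
  letI : Fintype H := Fintype.ofFinite H
  obtain ⟨q, hq⟩ := IsCyclic.exists_generator (α := H)
  haveI : (Rep.res H.subtype (Rep.trivial ℤ G ℤ)).IsTrivial := ⟨fun _ => rfl⟩
  rw [Nat.card_congr ((FiniteCyclic.groupCohomologyIsoEvenOfIsTrivial
      (Rep.res H.subtype (Rep.trivial ℤ G ℤ)) q hq 2 even_two).toLinearEquiv.toEquiv.trans
      (FiniteCyclic.intQuotientRangeSMulEquivZMod (Fintype.card H)).toEquiv),
    Nat.card_zmod, Nat.card_eq_fintype_card]

/-! ## §3. The units of `K_m` are cohomologically trivial (Neukirch II (4.3)), by counting -/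

section UnramifiedUnits

variable (K : Type) [Field K] [ValuativeRel K] [TopologicalSpace K] [IsNonarchimedeanLocalField K]

/-- In a split short exact sequence `0 → X₁ → X₂ → X₃ → 0` of `ℤ`-modules with `|X₂| = |X₃| = c ≠ 0`,
`X₁ = 0` (`|X₂| = |X₁| · |X₃|`). [cite: SerreLocalFields1979, Ch. XII §3 Prop. 4 (remark)] -/
theorem isZero_X₁_of_splitting_of_natCard_eq {X : ShortComplex (ModuleCat.{0} ℤ)} (s : X.Splitting)
    {c : ℕ} (hc : c ≠ 0) (h₂ : Nat.card X.X₂ = c) (h₃ : Nat.card X.X₃ = c) : IsZero X.X₁ := by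
  have e := (s.isoBinaryBiproduct ≪≫ ModuleCat.biprodIsoProd X.X₁ X.X₃).toLinearEquiv.toEquiv
  have hcard : Nat.card X.X₂ = Nat.card X.X₁ * Nat.card X.X₃ := by
    rw [Nat.card_congr e]
    exact Nat.card_prod _ _
  rw [h₂, h₃] at hcard
  have h1 : Nat.card X.X₁ = 1 := by
    have := hcard
    conv_lhs at this => rw [← one_mul c]
    exact (Nat.eq_of_mul_eq_mul_right (Nat.pos_of_ne_zero hc) this).symm
  haveI : Subsingleton X.X₁ := (Nat.card_eq_one_iff_unique.1 h1).1
  exact ModuleCat.isZero_of_subsingleton _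

/-- **Neukirch II (4.3) / Serre XII §3: the unit group `U_{K_m} = ker v_{K_m}` of the unramified level
`K_m/K` is cohomologically trivial** (`Ĥ^q(H, U_{K_m}) = 0` for every subgroup `H ≤ Gal(K_m/K)` and
every `q ∈ ℤ`).  Proof by counting through the SPLIT sequences
`0 → Hⁿ(H, U) → Hⁿ(H, K_mˣ) → Hⁿ(H, ℤ) → 0` (engine `Unramified.valuationShortComplex_map_res_shortExact`,
splitting by the invariant uniformiser `π_K`): `n = 1`: `H¹(H, K_mˣ) = 0` (Hilbert 90);
`n = 2`: `|H²(H, K_mˣ)| = |H|` (every local layer is a class module, `natCard_H2_res_units_of_isGalois`)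
and `|H²(H, ℤ)| = |H|`; then Neukirch I (7.1).
[cite: Neukirch2013, Part II §4 Thm. (4.3)][cite: SerreLocalFields1979, Ch. XII §3 Lemma 2 and Prop. 4] -/
theorem isCohomologicallyTrivial_units_unramifiedLevel {m : ℕ} (hm : 0 < m) :
    haveI := finiteDimensional_unramifiedLevel K hm
    IsCohomologicallyTrivial (Herbrand.kerRep
      (unitsValuation K (unramifiedLevel K m) (unramifiedLevel_le_sepClosure K hm))) := by
  haveI := finiteDimensional_unramifiedLevel K hm
  haveI := isGalois_unramifiedLevel K hm
  haveI := isCyclic_gal_unramifiedLevel K hm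
  obtain ⟨ϖ, hϖG, hϖ⟩ := exists_invariant_unitsValuation_eq_one K hm
  apply CohomologicalTriviality.isCohomologicallyTrivial_of_H1_H2
  · intro H
    have hX := Unramified.valuationShortComplex_map_res_shortExact
      (Rep.ofAlgebraAutOnUnits K (unramifiedLevel K m)) _ ϖ hϖG hϖ H 1
    exact @IsZero.of_mono _ _ _ _ _ _ hX.mono_f
      (InflationRestriction.isZero_H1_res_units K (unramifiedLevel K m) H)
  · intro H
    exact isZero_X₁_of_splitting_of_natCard_eq
      (Unramified.valuationSplittingMapRes (Rep.ofAlgebraAutOnUnits K (unramifiedLevel K m)) _ ϖ hϖG hϖ H 2)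
      (Nat.card_pos (α := H)).ne'
      (natCard_H2_res_units_of_isGalois K (unramifiedLevel K m) H)
      (natCard_H2_res_trivial_int_of_isCyclic H)

/-! ## §4. `(Gal(K_m/K), K_mˣ, v_{K_m}, π_K)` is an unramified layer of the engine; `inv(u) = 1/m` -/

/-- **The unramified level is an unramified layer in the engine's sense**: for ANY generator `σ` of the
cyclic group `Gal(K_m/K)` there is a `Gal`-invariant `ϖ ∈ K_mˣ` (a uniformiser of `K`) with
`Unramified.IsUnramified σ (K_mˣ) v_{K_m} ϖ` (generator, cohomologically trivial units, `v(ϖ) = 1`).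
[cite: Neukirch2013, Part II §4 Thm. (4.3) and Def. (4.5)][cite: SerreLocalFields1979, Ch. XIII §3] -/
theorem exists_isUnramified_unramifiedLevel {m : ℕ} (hm : 0 < m)
    (σ : unramifiedLevel K m ≃ₐ[K] unramifiedLevel K m) (hσ : ∀ x, x ∈ Subgroup.zpowers σ) :
    haveI := finiteDimensional_unramifiedLevel K hm
    ∃ ϖ : (Rep.ofAlgebraAutOnUnits K (unramifiedLevel K m)).V,
      Unramified.IsUnramified σ (Rep.ofAlgebraAutOnUnits K (unramifiedLevel K m))
        (unitsValuation K (unramifiedLevel K m) (unramifiedLevel_le_sepClosure K hm)) ϖ := by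
  haveI := finiteDimensional_unramifiedLevel K hm
  obtain ⟨ϖ, hϖG, hϖ⟩ := exists_invariant_unitsValuation_eq_one K hm
  exact ⟨ϖ, ⟨hσ, isCohomologicallyTrivial_units_unramifiedLevel K hm, hϖG, hϖ⟩⟩

/-- **`K_mˣ` is a class module with fundamental class the Frobenius class `u = [c_σ · π_K]` and
`inv_σ(u) = 1/m`** (Neukirch II (4.5)–(4.6) for the layer `K_m/K`; engine
`IsUnramified.isClassModule`, `invariantMap_H2π_cocycle`), for any generator `σ` of `Gal(K_m/K)`.
[cite: Neukirch2013, Part II §4 Def. (4.5), Thm. (4.6)][cite: SerreLocalFields1979, Ch. XIII §3] -/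
theorem exists_isClassModule_invariantMap_eq_unramifiedLevel {m : ℕ} (hm : 0 < m)
    (σ : unramifiedLevel K m ≃ₐ[K] unramifiedLevel K m) (hσ : ∀ x, x ∈ Subgroup.zpowers σ) :
    haveI := finiteDimensional_unramifiedLevel K hm
    ∃ φ : cocycles₂ (Rep.ofAlgebraAutOnUnits K (unramifiedLevel K m)),
      IsClassModule (Rep.ofAlgebraAutOnUnits K (unramifiedLevel K m)) φ ∧
        Unramified.invariantMap σ (Rep.ofAlgebraAutOnUnits K (unramifiedLevel K m))
          (unitsValuation K (unramifiedLevel K m) (unramifiedLevel_le_sepClosure K hm))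
          (H2π _ φ) = Submodule.Quotient.mk ((1 : ℚ) / m) := by
  haveI := finiteDimensional_unramifiedLevel K hm
  haveI := isGalois_unramifiedLevel K hm
  obtain ⟨ϖ, h⟩ := exists_isUnramified_unramifiedLevel K hm σ hσ
  refine ⟨h.cocycle, h.isClassModule, ?_⟩
  rw [h.invariantMap_H2π_cocycle, Fintype.card_eq_nat_card, IsGalois.card_aut_eq_finrank,
    finrank_unramifiedLevel K hm]

/-- **`inv_σ : H²(Gal(K_m/K), K_mˣ) ↪ ℚ/ℤ` is injective with image `(1/m)ℤ/ℤ`** for the unramified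
level (engine `IsUnramified.invariantMap_injective`, `range_invariantMap`).
[cite: Neukirch2013, Part II §4 Def. (4.5)][cite: SerreLocalFields1979, Ch. XIII §3 Prop. 6] -/
theorem invariantMap_injective_and_range_unramifiedLevel {m : ℕ} (hm : 0 < m)
    (σ : unramifiedLevel K m ≃ₐ[K] unramifiedLevel K m) (hσ : ∀ x, x ∈ Subgroup.zpowers σ) :
    haveI := finiteDimensional_unramifiedLevel K hm
    Function.Injective (Unramified.invariantMap σ (Rep.ofAlgebraAutOnUnits K (unramifiedLevel K m))
        (unitsValuation K (unramifiedLevel K m) (unramifiedLevel_le_sepClosure K hm))) ∧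
      (Unramified.invariantMap σ (Rep.ofAlgebraAutOnUnits K (unramifiedLevel K m))
        (unitsValuation K (unramifiedLevel K m) (unramifiedLevel_le_sepClosure K hm))).range =
        AddSubgroup.zmultiples (Submodule.Quotient.mk ((1 : ℚ) / m) : ratModInt) := by
  haveI := finiteDimensional_unramifiedLevel K hm
  haveI := isGalois_unramifiedLevel K hm
  obtain ⟨ϖ, h⟩ := exists_isUnramified_unramifiedLevel K hm σ hσ
  refine ⟨h.invariantMap_injective, ?_⟩
  rw [h.range_invariantMap, Fintype.card_eq_nat_card, IsGalois.card_aut_eq_finrank,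
    finrank_unramifiedLevel K hm]

end UnramifiedUnits

end UnitsLayer

end Literature.NumberTheory.GaloisRepresentations

end
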